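import Literature.NumberTheory.EllipticCurves.Wang2016.CongruentShaTwoByTwo
import Literature.NumberTheory.EllipticCurves.HeathBrown1994.CongruentTwoSelmerMonskyMatrix
import Literature.NumberTheory.EllipticCurves.QuadraticOrderPlace
import HarnessLib

/-!
# Wang 2016 (Sci. China Math. 59), Lemma 4 AS PRINTED — "`s₂(n) = 2` if and only if `h₄(n) = 1`" — and the KERNEL-DECIDABLE form of the door D-CM-3 (Monsky matrix + `δ_n` ⟹ full BSD with `#Ш(E_n)[2^∞] = 4`)

Sibling of `Wang2016/CongruentShaTwoByTwo.lean` (Wang Thm. 3, second part; writer of record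
`p2-monsky-lit`, p318976) and of `Wang2016/CongruentShaTwoByTwoThmOne.lean` (Wang Thm. 1; this
seat), importing the former and `HeathBrown1994/CongruentTwoSelmerMonskyMatrix.lean` (Monsky's
matrix, p317856) and re-declaring nothing of either.

HONEST FRAMING (cell `b2b-bsdres`, sub-lane `bsd-p2`, run/shared/lean/b2b/bsd-rank1-residual/p2/;
literature typer 1; thread L-Ш4 / door D-CM-3): ONE printed, proved LEMMA of a refereed paper
vendored as a named `Prop` (nothing asserted, nothing discharged, D-0014), every printed hypothesis
a binder; plus bookkeeping PROVED from tree theorems. PURPOSE (the consumer): the door D-CM-3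
(`Wang2016.bsdTriple_of_thm3`) quantifies over a quadratic field `K ∋ √−n` and asks for the
CLASS-GROUP binder `h₄(n) = 1` (`Tian2014.fourTwoCard (ClassGroup (𝓞 K)) = 2`), which the kernel
cannot decide; Wang's Lemma 4 says that on the Thm. 1 setting this binder IS the pure `2`-Selmer
rank condition `s₂(n) = 2`, which Monsky's matrix (`HeathBrown1994.monsky_card_selmerGroup_two_odd`,
a named fact of the tree) makes a finite `𝔽₂`-rank computation. With the tree's concrete
`sqrtField (−n) = ℚ[X]/(X² + n)` supplying the field `K` (§1, PROVED), the door becomes K-FREE and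
DECIDABLE PER `n` modulo SIX named journal facts (Wang Thm. 3, Wang Lemma 4, Monsky, Burungale–Tian
2026 Thm. 1.1, Deuring–Hecke, Burungale–Flach 2024 Cor. 2): §3, and the showcase `n = 17` (§4:
`y² = x³ − 289x`, `s(17) = 2`, `δ₁₇ = 1` ⟹ RANK ∧ SHAFIN ∧ LEAD with rank `0` and
`#Ш(E₁₇/ℚ)[2^∞] = 4` — a kernel pair with NON-TRIVIAL `Ш` at `2`). EVIDENCE of what print says;
nothing booked; no mark moved.

Source. Zhangjie Wang, *Congruent elliptic curves with non-trivial Shafarevich–Tate groups*,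
Sci. China Math. 59 (2016), no. 11, 2145–2166, doi 10.1007/s11425-015-0741-3 = arXiv:1511.03810
[Wang2016CongruentSha]. Text read: the held LaTeX-derived text `paper:arxiv-1511.03810` (chunks
`p0001`–`p0016`; locators `chunk:line`).

## The printed statements (verbatim)

* (p0003 L27–L29, strategy of the proof of Thm. 1) "a necessary condition of (ii) holds is
  `s₂(n) = 2`, where `s₂(n)` is the pure `2`-Selmer rank given by `rank_{𝔽₂} Sel₂(E_n)/E_n[2](ℚ)`.
  By Monsky matrix (2.1) and Redei matrix (3.1), we deduce that `s₂(n) = 2` is equivalent to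
  `h₄(n) = 1`."
* (p0010 L7–L16, §4.1) "For a positive square-free integer `n = p₁⋯p_k ≡ 1 (mod 8)` with all prime
  factors congruent to `1 (mod 4)`, the corresponding Monsky matrix of `Sel₂(E_n)` and Redei matrix
  of `ℚ(√−n)` are of the form `M = ( A + D₂  D₂ ; D₂  A + D₂ )`, `R = ( A | B )` … And we have
  `h₄(n) = k − rank R`."
* **Lemma 4** (p0010 L20–L22). "For a positive square-free integer `n = p₁⋯p_k ≡ 1 (mod 8)` with
  all `p_i ≡ 1 (mod 4)`, then `s₂(n) = 2` if and only if `h₄(n) = 1`." (L22–L27 continue with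
  explicit generators of `Sel₂(E_n/ℚ)/E_n(ℚ)[2]`, not typed; proof L28–L69: "this is equivalent to
  show that the rank of `M` is `2k − 2` if and only if that of `R` is `k − 1`", elementary row
  operations.)

## What is typed, and how (tree dictionary)

* "`s₂(n) = 2`" ↦ `Nat.card ((congruentNumberCurve n).selmerGroup 2) = 16`: the tree's `2`-Selmer
  group `Sel₂(E_n/ℚ) ⊆ H¹(ℚ, E_n[2])` contains the Kummer image of `E_n(ℚ)[2] ≅ (ℤ/2)²`
  (`Smith2016.natCard_torsionBy_two_congruentNumberCurve`; `E_n(ℚ)` has no point of order `4`), so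
  `#Sel₂(E_n) = 2^{2 + s₂(n)}` — the normalisation PRINTED by Heath-Brown/Monsky, "`#S⁽²⁾ = 2^{2+s(D)}`",
  and used by the tree's `HeathBrown1994.monsky_card_selmerGroup_two_odd`; `s₂(n) = 2` ⟺ `# = 16`.
* "`h₄(n) = 1`" ↦ `Tian2014.fourTwoCard (ClassGroup (𝓞 K)) = 2` for any quadratic `K ∋ √−n`
  (`Tian2014.IsQuadraticFieldOfSqrt K (−n)`), exactly as in the sibling facts.
* `K = ℚ(√−n)` made CONCRETE (§1): the tree's `sqrtField (−n)` is a number field of degree `2`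
  containing a square root of `−n` — so the universally quantified `K` of the sibling facts can
  always be instantiated, and conclusions not mentioning `K` become `K`-free.

No `_holds` is expected for the fact (Rédei matrices are not in the tree). Consumers take
`(h : lem4_card_selmerGroup_two_eq_sixteen_iff_h4)`.

## References
* [Wang2016CongruentSha] Z. Wang, Sci. China Math. 59 (2016) 2145–2166 = arXiv:1511.03810: §1
  strategy (chunk p0003 L27–L29), §4.1 setting (p0010 L7–L16), Lemma 4 (p0010 L20–L27), its proof
  (p0010 L28–L69), Thm. 3 (p0011 L107–L131).
* [HeathBrown1994SelmerCongruentII] appendix (Monsky): `#S⁽²⁾ = 2^{2+s(D)}`, `s(D) = 2k − rank M`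
  (tree `HeathBrown1994/CongruentTwoSelmerMonskyMatrix.lean`).
* [BurungaleTian2026, Thm. 1.1], [BurungaleFlach2024, Cor. 2]: through `Wang2016.bsdTriple_of_thm3`.
-/

noncomputable section

open NumberField WeierstrassCurve Polynomial Literature.NumberTheory.EllipticCurves
  Literature.NumberTheory.EllipticCurves.HeathBrown1994

namespace Literature.NumberTheory.EllipticCurves.Wang2016

/-! ### §1. A concrete `ℚ(√d)` for the universally quantified field binder (PROVED; no fact) -/

/-- The tree's `sqrtField d = ℚ[X]/(X² − d)` (`d < 0`) is a number field (characteristic `0`,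
finite over `ℚ` — both already instances in `QuadraticOrderPlace.lean`). [folklore] -/
instance numberField_sqrtField (d : ℤ) [Fact (d < 0)] : NumberField (sqrtField d) where
  to_charZero := inferInstance
  to_finiteDimensional := inferInstance

/-- `sqrtField d` is "a quadratic field `ℚ(√d)`" in the sense of the sibling facts: degree `2` over
`ℚ` and containing a square root of `d` (`sqrtField.finrank_eq_two`, `sqrtField.r_sq'`).
[cite: Wang2016CongruentSha, §1 notation "K = ℚ(√−n)" (arXiv:1511.03810 chunk p0003 L14)] -/
theorem isQuadraticFieldOfSqrt_sqrtField (d : ℤ) [Fact (d < 0)] :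
    Tian2014.IsQuadraticFieldOfSqrt (sqrtField d) d :=
  ⟨sqrtField.finrank_eq_two d, sqrtField.r d, sqrtField.r_sq' d⟩

/-! ### §2. The named fact: Wang 2016, Lemma 4 (nothing asserted) -/

/-- **Wang 2016, Lemma 4** (verbatim in the module docstring): for `n` a square-free positive
integer, `n ≡ 1 (mod 8)`, all prime factors `≡ 1 (mod 4)`: `s₂(n) = 2` (pure `2`-Selmer rank of
`E_n : y² = x³ − n²x`, i.e. `#Sel₂(E_n/ℚ) = 2^{2+2} = 16`) if and only if `h₄(n) = 1` (`#(𝒜[2] ∩ 2𝒜) = 2`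
for the class group `𝒜` of `ℚ(√−n)`, read in any quadratic field `K ∋ √−n`). A proved LEMMA of the
source (Monsky matrix vs. Rédei matrix, elementary row operations), vendored as a named fact; no
`_holds` expected (no Rédei matrix in the tree).
[cite: Wang2016CongruentSha, Lemma 4 (arXiv:1511.03810 chunk p0010 L20–L22); proof chunk p0010 L28–L69; §1 chunk p0003 L27–L29] -/
def lem4_card_selmerGroup_two_eq_sixteen_iff_h4 : Prop :=
  ∀ (n : ℕ), Squarefree n → n % 8 = 1 → (∀ p ∈ n.primeFactors, p % 4 = 1) →
    ∀ (K : Type) [Field K] [NumberField K], Tian2014.IsQuadraticFieldOfSqrt K (-(n : ℤ)) →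
      (Nat.card ((congruentNumberCurve n).selmerGroup 2) = 16 ↔
        Tian2014.fourTwoCard (ClassGroup (𝓞 K)) = 2)

/-! ### §3. PROVED: the K-free, decidable form of the door D-CM-3 -/

section MonskyFamily

variable {k : ℕ} (p : Fin k → ℕ)

/-- Primes `≡ 1 (mod 8)` are odd. [folklore] -/
private theorem odd_of_mod_eight (h8 : ∀ i, p i % 8 = 1) (i : Fin k) : Odd (p i) :=
  Nat.odd_iff.mpr (by have := h8 i; omega)

/-- A product of numbers `≡ 1 (mod 8)` is `≡ 1 (mod 8)`. [folklore] -/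
private theorem prod_mod_eight_eq_one (h8 : ∀ i, p i % 8 = 1) : (∏ i, p i) % 8 = 1 := by
  rw [Finset.prod_nat_mod]
  simp [h8]

/-- Every prime factor of `p₁⋯p_k` (the `pᵢ` prime) is one of the `pᵢ`. [folklore] -/
private theorem exists_eq_of_mem_primeFactors_prod (hp : ∀ i, (p i).Prime) {q : ℕ}
    (hq : q ∈ (∏ i, p i).primeFactors) : ∃ i, q = p i := by
  have hqp : q.Prime := Nat.prime_of_mem_primeFactors hq
  obtain ⟨i, -, hi⟩ :=
    ((Nat.Prime.prime hqp).dvd_finsetProd_iff _).mp (Nat.dvd_of_mem_primeFactors hq)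
  exact ⟨i, (Nat.prime_dvd_prime_iff_eq hqp (hp i)).mp hi⟩

/-- **`s(D) = 2` in Monsky's matrix form ⟹ `#Sel₂(E_D) = 16`** (`D = p₁⋯p_k`, distinct primes
`≡ 1 (mod 8)`), under Monsky's named fact. [cite: HeathBrown1994SelmerCongruentII, Appendix (Monsky), typescript p. 39 L10–L33] -/
theorem card_selmerGroup_two_eq_sixteen_of_monsky (hM : monsky_card_selmerGroup_two_odd)
    (hp : ∀ i, (p i).Prime) (h8 : ∀ i, p i % 8 = 1) (hinj : Function.Injective p)
    (hs : monskySelmerRankOdd p = 2) :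
    Nat.card ((congruentNumberCurve (∏ i, p i)).selmerGroup 2) = 16 := by
  rw [hM k p hp (odd_of_mod_eight p h8) hinj, hs]
  norm_num

/-- **Lemma 4 + Monsky: the class-group binder `h₄(n) = 1` of the sibling facts from a matrix rank.**
For `n = p₁⋯p_k` (distinct primes `≡ 1 (mod 8)`) with Monsky rank `s(n) = 2`, every quadratic
field `K ∋ √−n` has `#(Cl(K)[2] ∩ 2Cl(K)) = 2`. [cite: Wang2016CongruentSha, Lemma 4 (chunk p0010 L20–L22)]
[cite: HeathBrown1994SelmerCongruentII, Appendix (Monsky), typescript p. 39 L10–L33] -/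
theorem fourTwoCard_eq_two_of_lem4_of_monsky (hL : lem4_card_selmerGroup_two_eq_sixteen_iff_h4)
    (hM : monsky_card_selmerGroup_two_odd) (hp : ∀ i, (p i).Prime) (h8 : ∀ i, p i % 8 = 1)
    (hinj : Function.Injective p) (hs : monskySelmerRankOdd p = 2) (K : Type) [Field K]
    [NumberField K] (hK : Tian2014.IsQuadraticFieldOfSqrt K (-((∏ i, p i : ℕ) : ℤ))) :
    Tian2014.fourTwoCard (ClassGroup (𝓞 K)) = 2 :=
  (hL (∏ i, p i) (squarefree_prod_of_injective p hp hinj) (prod_mod_eight_eq_one p h8)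
    (fun q hq => by
      obtain ⟨i, rfl⟩ := exists_eq_of_mem_primeFactors_prod p hp hq
      have := h8 i; omega) K hK).mp
    (card_selmerGroup_two_eq_sixteen_of_monsky p hM hp h8 hinj hs)

/-- **The door D-CM-3, K-free and decidable per `n`.** For `n = p₁⋯p_k` a product of distinct
primes `≡ 1 (mod 8)` with Monsky rank `s(n) = 2` (an `𝔽₂`-rank of `HeathBrown1994.monskyMatrixOdd`)
and `δ_n` odd (`Wang2016.deltaCount`, one representation `p = u² + 8v²` per prime): RANK ∧ SHAFIN ∧
LEAD for `congruentNumberCurve n`, Mordell–Weil rank `0`, and `#Ш(E_n/ℚ)[2^∞] = 4` — modulo SIX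
named journal facts as explicit binders (Wang Thm. 3 `h3`, Wang Lemma 4 `hL`, Monsky `hM`,
Burungale–Tian 2026 Thm. 1.1 `hBT`, Deuring–Hecke `hH`, Burungale–Flach 2024 Cor. 2 `hBF`); the
field binder is instantiated at `sqrtField (−n)` (§1). Nothing asserted.
[cite: Wang2016CongruentSha, Thm. 3 (chunk p0011 L107–L131) and Lemma 4 (chunk p0010 L20–L22)]
[cite: HeathBrown1994SelmerCongruentII, Appendix (Monsky), typescript p. 39 L10–L33]
[cite: BurungaleTian2026, Thm. 1.1] [cite: BurungaleFlach2024, Thm. 1.1 and Cor. 2] -/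
theorem bsdTriple_of_thm3_of_lem4_of_monsky (h3 : thm3_rank_zero_and_sha_two_by_two)
    (hL : lem4_card_selmerGroup_two_eq_sixteen_iff_h4) (hM : monsky_card_selmerGroup_two_odd)
    (hBT : burungaleTian_analyticRank_eq_zero_of_selmerCorank_eq_zero_of_hasCM)
    (hH : hasEntireLFunction_of_j_mem_maximalCMJInvariants)
    (hBF : bsdTriple_of_hasCM_of_L_one_ne_zero) (hp : ∀ i, (p i).Prime)
    (h8 : ∀ i, p i % 8 = 1) (hinj : Function.Injective p) (hs : monskySelmerRankOdd p = 2)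
    {n : ℕ} (hn : ∏ i, p i = n) (hδ : Odd (deltaCount n)) :
    haveI := isElliptic_congruentNumberCurve
      (Squarefree.ne_zero (hn ▸ squarefree_prod_of_injective p hp hinj))
    haveI := isGloballyMinimal_congruentNumberCurve (hn ▸ squarefree_prod_of_injective p hp hinj)
    (congruentNumberCurve n).BSDTriple ∧ (congruentNumberCurve n).mordellWeilRank = 0 ∧
      Nat.card (AddCommGroup.primaryComponent (congruentNumberCurve n).sha 2) = 4 := by
  subst hn
  have hsq : Squarefree (∏ i, p i) := squarefree_prod_of_injective p hp hinj
  have h8' : ∀ q ∈ (∏ i, p i).primeFactors, q % 8 = 1 := fun q hq => by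
    obtain ⟨i, rfl⟩ := exists_eq_of_mem_primeFactors_prod p hp hq
    exact h8 i
  haveI : Fact (-((∏ i, p i : ℕ) : ℤ) < 0) :=
    ⟨by have := Squarefree.ne_zero hsq; omega⟩
  exact bsdTriple_of_thm3 h3 hBT hH hBF hsq h8' (sqrtField (-((∏ i, p i : ℕ) : ℤ)))
    (isQuadraticFieldOfSqrt_sqrtField _)
    (fourTwoCard_eq_two_of_lem4_of_monsky p hL hM hp h8 hinj hs _
      (isQuadraticFieldOfSqrt_sqrtField _))
    hδ

/-- **`BSD(E_n, ℓ)` at every prime `ℓ`** on the decidable form of the door (in particular `ℓ = 2`,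
where `#Ш(E_n)[2^∞] = 4`). [cite: Wang2016CongruentSha, Thm. 3 and Lemma 4] [cite: Miller2011LMS, §1 and Def. 1.1] -/
theorem forall_bsdp_of_thm3_of_lem4_of_monsky (h3 : thm3_rank_zero_and_sha_two_by_two)
    (hL : lem4_card_selmerGroup_two_eq_sixteen_iff_h4) (hM : monsky_card_selmerGroup_two_odd)
    (hBT : burungaleTian_analyticRank_eq_zero_of_selmerCorank_eq_zero_of_hasCM)
    (hH : hasEntireLFunction_of_j_mem_maximalCMJInvariants)
    (hBF : bsdTriple_of_hasCM_of_L_one_ne_zero) (hp : ∀ i, (p i).Prime)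
    (h8 : ∀ i, p i % 8 = 1) (hinj : Function.Injective p) (hs : monskySelmerRankOdd p = 2)
    {n : ℕ} (hn : ∏ i, p i = n) (hδ : Odd (deltaCount n)) (ℓ : ℕ) (hℓ : ℓ.Prime) :
    haveI := isElliptic_congruentNumberCurve
      (Squarefree.ne_zero (hn ▸ squarefree_prod_of_injective p hp hinj))
    haveI := isGloballyMinimal_congruentNumberCurve (hn ▸ squarefree_prod_of_injective p hp hinj)
    BSDp (congruentNumberCurve n) ℓ :=
  haveI := isElliptic_congruentNumberCurve
    (Squarefree.ne_zero (hn ▸ squarefree_prod_of_injective p hp hinj))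
  haveI := isGloballyMinimal_congruentNumberCurve (hn ▸ squarefree_prod_of_injective p hp hinj)
  forall_bsdp_of_bsdTriple' _
    (bsdTriple_of_thm3_of_lem4_of_monsky p h3 hL hM hBT hH hBF hp h8 hinj hs hn hδ).1 ℓ hℓ

end MonskyFamily

/-! ### §4. Showcase (nothing asserted): `n = 17`, `y² = x³ − 289x` — `s(17) = 2`, `δ₁₇ = 1` -/

/-- `(2/17) = +1` (`17 ≡ 1 (mod 8)`; `6² ≡ 2`). [cite: IrelandRosen1990, Ch. 5 §1 Prop. 5.1.3] -/
theorem jacobiSym_two_seventeen : jacobiSym 2 17 = 1 := by norm_num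

/-- `(−2/17) = +1` (`7² = 49 ≡ −2 (mod 17)`). [cite: IrelandRosen1990, Ch. 5 §1] -/
theorem jacobiSym_neg_two_seventeen : jacobiSym (-2) 17 = 1 := by norm_num

/-- Monsky's matrix for `D = 17` VANISHES: `A = (0)` (one prime), `D₂ = D₋₂ = (0)` since `2` and
`−2` are squares mod `17`; so `rank M = 0` and `s(17) = 2·1 − 0 = 2`.
[cite: HeathBrown1994SelmerCongruentII, Appendix (Monsky), typescript p. 39 L27–L33] -/
theorem monskyMatrixOdd_seventeen : monskyMatrixOdd ![17] = 0 := by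
  have h2 : addLegendreSym 2 17 = 0 := addLegendreSym_of_eq_one jacobiSym_two_seventeen
  have hm2 : addLegendreSym (-2) 17 = 0 := addLegendreSym_of_eq_one jacobiSym_neg_two_seventeen
  ext i j
  rcases i with i | i <;> rcases j with j | j <;>
    · obtain rfl : i = 0 := Subsingleton.elim _ _
      obtain rfl : j = 0 := Subsingleton.elim _ _
      simp [monskyMatrixOdd, legendreMatrix, legendreDiagonal, Matrix.fromBlocks, h2, hm2]

/-- `s(17) = 2` in Monsky's matrix form (Heath-Brown §1: for a prime `D ≡ 1 (mod 8)`, `s(D) = 2`).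
[cite: HeathBrown1994SelmerCongruentII, §1 typescript p. 6 L26–L28; Appendix p. 39 L33] -/
theorem monskySelmerRankOdd_seventeen : monskySelmerRankOdd ![17] = 2 := by
  rw [monskySelmerRankOdd, monskyMatrixOdd_seventeen, Matrix.rank_zero]

/-- `δ₁₇ = 1`: `17 = 3² + 8·1²` with `v = 1` odd. [cite: Wang2016CongruentSha, Thm. 3 (1) (chunk p0011 L110)] -/
theorem isDeltaOne_seventeen : IsDeltaOne 17 := ⟨3, 1, by norm_num, odd_one⟩

/-- `δ_17 = #{p ∣ 17 : δ_p = 1} = 1` (odd). [cite: Wang2016CongruentSha, Thm. 3 (i) (chunk p0011 L127)] -/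
theorem deltaCount_seventeen : deltaCount 17 = 1 := by
  rw [deltaCount, Nat.Prime.primeFactors (by norm_num : Nat.Prime 17), Finset.filter_singleton,
    if_pos isDeltaOne_seventeen, Finset.card_singleton]

/-- **Showcase `E₁₇ : y² = x³ − 289x`** (`17 ≡ 1 (mod 8)`, `Cl(ℚ(√−17)) ≅ ℤ/4`: `h₄ = 1`, `h₈ = 0`;
a rank-`0` curve with `Ш(E₁₇/ℚ)[2^∞] ≅ (ℤ/2)²`, `#Ш_an = 4`): modulo the six named journal facts,
the kernel derives RANK ∧ SHAFIN ∧ LEAD — hence `BSD(E₁₇, 2)` — with Mordell–Weil rank `0` and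
`#Ш(E₁₇/ℚ)[2^∞] = 4` from two DECIDED inputs, `s(17) = 2` (Monsky's matrix is zero) and `δ₁₇ = 1`
(`17 = 3² + 8·1²`). A kernel pair with NON-TRIVIAL `Ш` at `2`; nothing asserted.
[cite: Wang2016CongruentSha, Thm. 3 and Lemma 4] [cite: HeathBrown1994SelmerCongruentII, §1 typescript p. 6 L26–L28]
[cite: BurungaleTian2026, Thm. 1.1] [cite: BurungaleFlach2024, Thm. 1.1 and Cor. 2] -/
theorem bsdTriple_congruentNumberCurve_seventeen_journal (h3 : thm3_rank_zero_and_sha_two_by_two)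
    (hL : lem4_card_selmerGroup_two_eq_sixteen_iff_h4) (hM : monsky_card_selmerGroup_two_odd)
    (hBT : burungaleTian_analyticRank_eq_zero_of_selmerCorank_eq_zero_of_hasCM)
    (hH : hasEntireLFunction_of_j_mem_maximalCMJInvariants)
    (hBF : bsdTriple_of_hasCM_of_L_one_ne_zero) :
    haveI := isElliptic_congruentNumberCurve (n := 17) (by norm_num)
    haveI := isGloballyMinimal_congruentNumberCurve (n := 17) (by norm_num : Nat.Prime 17).squarefree
    (congruentNumberCurve 17).BSDTriple ∧ (congruentNumberCurve 17).mordellWeilRank = 0 ∧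
      Nat.card (AddCommGroup.primaryComponent (congruentNumberCurve 17).sha 2) = 4 :=
  bsdTriple_of_thm3_of_lem4_of_monsky ![17] h3 hL hM hBT hH hBF
    (fun i => by fin_cases i; norm_num) (fun i => by fin_cases i; rfl)
    (Function.injective_of_subsingleton _) monskySelmerRankOdd_seventeen (by simp)
    (by rw [deltaCount_seventeen]; exact odd_one)

end Literature.NumberTheory.EllipticCurves.Wang2016

end
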